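import Summits.FinalStateConjecture.FinalStateConjecture.Theorems.EIHFluxBalanceInertialRecessionChargeKinematicsRuleWindowLaw
import Summits.FinalStateConjecture.FinalStateConjecture.Theorems.EIHFluxBalanceInertialRecessionChargeKinematicsIsolated

/-!
# Route EIHFluxBalance — `InertialRecession`, line `old-light-leaves-the-cone`: charge kinematics, XXVIII (general N: certified rates, uniform packages, coordinate facts)
Helper file for the crux `stmt-FinalStateConjecture-10166`, second line lead, endgame stub
`stub_expandingChargeKinematics` (S4) FOR GENERAL `N`. Certified rates of inter-class pairs (`certify_rate`), uniform rule-window packages over all (cluster, anchor)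
pairs (`rule_packages`), small helpers, and the facts about the certified coordinates (`coordinate_facts`).
Mathlib-only real analysis over the stub's verbatim hypotheses ([folklore]); the abstract charge `P` is adversarial.
-/
set_option linter.dupNamespace false

noncomputable section

open Filter Set Metric Real
open scoped Topology

namespace Summit.FinalStateConjecture.FinalStateConjecture.Theorems.ChargeKinematics

open Literature.Geometry.Lorentzian

/-! ## Certified rates and uniform packages -/

section RunPrep

open MeasureTheory intervalIntegral

variable {N : ℕ} {M : Fin N → ℝ} {ξ v : Fin N → ℝ → E3} {κ : ℝ} {P : ℝ → E3 → ℝ → Fin 4 → ℝ}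

/-- **Certified rate of an inter-class pair.** If `⟨u, v_b⁰ − v_x⁰⟩ = ‖v_b⁰ − v_x⁰‖ ≥ G`, the velocities
moved by at most `α₁`, `α₂` and the slaving defects are `≤ σ`, then `⟨u, ξ_b' − ξ_x'⟩ ≥ G − α₁ − α₂ − 2σ`.
[folklore] -/
theorem certify_rate {u vb₀ vx₀ vb vx db dx : E3} {G α₁ α₂ σ : ℝ} (hu : ‖u‖ = 1)
    (hur : @inner ℝ E3 _ u (vb₀ - vx₀) = ‖vb₀ - vx₀‖) (hbig : G ≤ ‖vb₀ - vx₀‖)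
    (hvb : ‖vb - vb₀‖ ≤ α₁) (hvx : ‖vx - vx₀‖ ≤ α₂) (hsb : ‖db - vb‖ ≤ σ) (hsx : ‖dx - vx‖ ≤ σ) :
    G - α₁ - α₂ - 2 * σ ≤ @inner ℝ E3 _ u (db - dx) := by
  have hsplit : @inner ℝ E3 _ u (db - dx) = @inner ℝ E3 _ u (vb₀ - vx₀) +
      @inner ℝ E3 _ u ((vb - vb₀) - (vx - vx₀)) + @inner ℝ E3 _ u ((db - vb) - (dx - vx)) := by
    simp only [← inner_add_right]
    congr 1; abel
  have h1 : |@inner ℝ E3 _ u ((vb - vb₀) - (vx - vx₀))| ≤ α₁ + α₂ :=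
    (abs_inner_le_norm_of_unit hu).trans ((norm_sub_le _ _).trans (add_le_add hvb hvx))
  have h2 : |@inner ℝ E3 _ u ((db - vb) - (dx - vx))| ≤ σ + σ :=
    (abs_inner_le_norm_of_unit hu).trans ((norm_sub_le _ _).trans (add_le_add hsb hsx))
  rw [hsplit, hur]
  rw [abs_le] at h1 h2
  linarith only [h1.1, h2.1, hbig]

/-- **Uniform rule-window packages.** The conclusion of `rule_window_law` with ONE set of constants
`(C_w, C', ψ*, T_w, ζ, D, η)` valid for every cluster `U` and anchor `a` simultaneously (sums / suprema /
infima over the finite family). [folklore] -/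
theorem rule_packages (hκ0 : 0 < κ) (hκ1 : κ < 1)
    (hξ : ∀ i, ContDiff ℝ ((⊤ : ℕ∞) : WithTop ℕ∞) (ξ i))
    (hcone : ∀ i, ∀ᶠ t in atTop, ‖ξ i t‖ ≤ κ ^ 2 * t)
    (hsep : ∀ i j, i ≠ j → Tendsto (fun t ↦ ‖ξ i t - ξ j t‖) atTop atTop)
    (hk : ∃ k : ℝ, 0 ≤ k ∧ k < 1 ∧ ∀ i, ∀ᶠ t in atTop, ‖v i t‖ ≤ k)
    (hslave : ∀ i, Tendsto (fun t ↦ deriv (ξ i) t - v i t) atTop (𝓝 0))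
    (hW : ∀ δ : ℝ, 0 < δ → δ < 1 → ∃ (C R₀ T : ℝ) (η : ℝ → ℝ), Tendsto η atTop (𝓝 0) ∧ ∀ (t₁ t₂ : ℝ) (c : ℝ → E3) (R : ℝ → ℝ), T ≤ t₁ → t₁ ≤ t₂ → (∀ s ∈ Set.Icc t₁ t₂, ∀ s' ∈ Set.Icc t₁ t₂, ‖c s - c s'‖ ≤ 2 * |s - s'| ∧ |R s - R s'| ≤ 2 * |s - s'|) → (∀ s ∈ Set.Icc t₁ t₂, (R₀ ≤ R s ∧ ‖c s‖ + R s ≤ (κ + κ ^ 2) / 2 * s ∧ ∀ j, ‖ξ j s - c s‖ ≤ (1 - δ) * R s ∨ (1 + δ) * R s ≤ ‖ξ j s - c s‖)) → ∀ μ : Fin 4, |P t₂ (c t₂) (R t₂) μ - P t₁ (c t₁) (R t₁) μ| ≤ C * (∫ s in t₁..t₂, ((R s) ^ 2)⁻¹ + ((R s) ^ (7 / 4 : ℝ))⁻¹) + η t₁)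
    (hI : ∃ (C R₀ T : ℝ) (ζ : ℝ → ℝ), Tendsto ζ atTop (𝓝 0) ∧ (∀ (t : ℝ) (i : Fin N) (R : ℝ), T ≤ t → R₀ ≤ R → ‖ξ i t‖ + R ≤ (κ + κ ^ 2) / 2 * t → (∀ j, j ≠ i → 3 * R ≤ ‖ξ i t - ξ j t‖) → |P t (ξ i t) R 0 - M i * (√(1 - ‖v i t‖ ^ 2))⁻¹| ≤ ζ t + C / R ∧ ∀ k : Fin 3, |P t (ξ i t) R k.succ - M i * (√(1 - ‖v i t‖ ^ 2))⁻¹ * v i t k| ≤ ζ t + C / R) ∧ (∀ (t : ℝ) (c : E3) (R : ℝ) (A : Finset (Fin N)) (ρ : Fin N → ℝ), T ≤ t → R₀ ≤ R → ‖c‖ + R ≤ (κ + κ ^ 2) / 2 * t → (∀ j ∈ A, ‖ξ j t - c‖ ≤ R / 2) → (∀ j ∉ A, 2 * R ≤ ‖ξ j t - c‖) → (∀ j ∈ A, R₀ ≤ ρ j ∧ ρ j ≤ R / 4 ∧ ∀ j', j' ≠ j → 3 * ρ j ≤ ‖ξ j t - ξ j' t‖) → ∀ μ : Fin 4, |P t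 c R μ - ∑ j ∈ A, P t (ξ j t) (ρ j) μ| ≤ C * (R⁻¹ + ∑ j ∈ A, (ρ j)⁻¹) + ζ t))
    (hpair : ∃ p : Fin N × Fin N, p.1 ≠ p.2) {c₂ : ℝ}
    (hc₂ : 0 < c₂) (hc₂κ : c₂ ≤ (κ - κ ^ 2) / 2) (hc₂1 : c₂ ≤ 1) :
    ∃ (Cw C' ψst Tw : ℝ) (ζ D : ℝ → ℝ), 0 ≤ Cw ∧ 0 ≤ C' ∧ 0 < ψst ∧ Tendsto ζ atTop (𝓝 0) ∧
      Tendsto D atTop atTop ∧ (∀ t, Tw ≤ t → 0 ≤ ζ t ∧ 1 ≤ D t) ∧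
      ∃ ηa : ℝ → ℝ, Tendsto ηa atTop (𝓝 0) ∧ (∀ t, 0 ≤ ηa t) ∧
      ∀ (U : Finset (Fin N)) (a : Fin N),
      ∀ (ψ₀ : ℝ), ψst ≤ ψ₀ → ∀ (s₁ s₂ : ℝ) (ψ : ℝ → ℝ), Tw ≤ s₁ → ψ₀ ≤ c₂ * s₁ → s₁ ≤ s₂ →
        (∀ s ∈ Set.Icc s₁ s₂, ∀ s' ∈ Set.Icc s₁ s₂, |ψ s - ψ s'| ≤ 4 * |s - s'|) →
        (∀ s ∈ Set.Icc s₁ s₂, ψ₀ ≤ ψ s ∧ (∀ j ∈ U, 4 * ‖ξ a s - ξ j s‖ ≤ ψ s ∧ 2 * ‖ξ a s - ξ j s‖ ≤ c₂ * s) ∧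
          ∀ l ∉ U, ψ s ≤ ‖ξ l s - ξ a s‖) →
        (∀ μ : Fin 4, |P s₂ (ξ a s₂) (min (ψ s₂ / 2) (c₂ * s₂)) μ -
            P s₁ (ξ a s₁) (min (ψ s₁ / 2) (c₂ * s₁)) μ| ≤
          Cw * (∫ s in s₁..s₂, ((min (ψ s / 2) (c₂ * s)) ^ 2)⁻¹ +
            ((min (ψ s / 2) (c₂ * s)) ^ (7 / 4 : ℝ))⁻¹) + ηa s₁) ∧
        (∀ s ∈ Set.Icc s₁ s₂,
          |P s (ξ a s) (min (ψ s / 2) (c₂ * s)) 0 - ∑ j ∈ U, M j * (√(1 - ‖v j s‖ ^ 2))⁻¹| ≤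
              (1 + U.card) * ζ s + C' * (2 * (1 + 8 * U.card) / ψ₀ + 6 * U.card / D s) ∧
          ∀ k' : Fin 3, |P s (ξ a s) (min (ψ s / 2) (c₂ * s)) k'.succ -
              ∑ j ∈ U, M j * (√(1 - ‖v j s‖ ^ 2))⁻¹ * v j s k'| ≤
              (1 + U.card) * ζ s + C' * (2 * (1 + 8 * U.card) / ψ₀ + 6 * U.card / D s)) := by
  classical
  have hfam : ∀ q : Finset (Fin N) × Fin N, ∃ (Cw C' ψst Tw : ℝ) (ζ D : ℝ → ℝ), 0 ≤ Cw ∧ 0 ≤ C' ∧ 0 < ψst ∧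
      Tendsto ζ atTop (𝓝 0) ∧ Tendsto D atTop atTop ∧ (∀ t, Tw ≤ t → 0 ≤ ζ t ∧ 1 ≤ D t) ∧
      ∃ ηa : ℝ → ℝ, Tendsto ηa atTop (𝓝 0) ∧ (∀ t, 0 ≤ ηa t) ∧
      ∀ (ψ₀ : ℝ), ψst ≤ ψ₀ → ∀ (s₁ s₂ : ℝ) (ψ : ℝ → ℝ), Tw ≤ s₁ → ψ₀ ≤ c₂ * s₁ → s₁ ≤ s₂ →
        (∀ s ∈ Set.Icc s₁ s₂, ∀ s' ∈ Set.Icc s₁ s₂, |ψ s - ψ s'| ≤ 4 * |s - s'|) →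
        (∀ s ∈ Set.Icc s₁ s₂, ψ₀ ≤ ψ s ∧ (∀ j ∈ q.1, 4 * ‖ξ q.2 s - ξ j s‖ ≤ ψ s ∧
          2 * ‖ξ q.2 s - ξ j s‖ ≤ c₂ * s) ∧ ∀ l ∉ q.1, ψ s ≤ ‖ξ l s - ξ q.2 s‖) →
        (∀ μ : Fin 4, |P s₂ (ξ q.2 s₂) (min (ψ s₂ / 2) (c₂ * s₂)) μ -
            P s₁ (ξ q.2 s₁) (min (ψ s₁ / 2) (c₂ * s₁)) μ| ≤
          Cw * (∫ s in s₁..s₂, ((min (ψ s / 2) (c₂ * s)) ^ 2)⁻¹ +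
            ((min (ψ s / 2) (c₂ * s)) ^ (7 / 4 : ℝ))⁻¹) + ηa s₁) ∧
        (∀ s ∈ Set.Icc s₁ s₂,
          |P s (ξ q.2 s) (min (ψ s / 2) (c₂ * s)) 0 - ∑ j ∈ q.1, M j * (√(1 - ‖v j s‖ ^ 2))⁻¹| ≤
              (1 + (q.1).card) * ζ s + C' * (2 * (1 + 8 * (q.1).card) / ψ₀ + 6 * (q.1).card / D s) ∧
          ∀ k' : Fin 3, |P s (ξ q.2 s) (min (ψ s / 2) (c₂ * s)) k'.succ -
              ∑ j ∈ q.1, M j * (√(1 - ‖v j s‖ ^ 2))⁻¹ * v j s k'| ≤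
              (1 + (q.1).card) * ζ s + C' * (2 * (1 + 8 * (q.1).card) / ψ₀ + 6 * (q.1).card / D s)) :=
    fun q ↦ rule_window_law hκ0 hκ1 hξ hcone hsep hk hslave hW hI q.1 q.2 hpair hc₂ hc₂κ hc₂1
  clear hW hI
  choose Cw C' ψst Tw ζ D hCw hC' hψst hζ hD hTw ηa hηa hηa0 hcl using hfam
  -- the family is a nonempty finite type
  obtain ⟨p, hp⟩ := hpair
  have hne : (Finset.univ : Finset (Finset (Fin N) × Fin N)).Nonempty := ⟨(∅, p.1), Finset.mem_univ _⟩
  refine ⟨∑ q, Cw q, ∑ q, C' q, Finset.univ.sup' hne ψst, Finset.univ.sup' hne Tw,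
    fun t ↦ ∑ q, |ζ q t|, fun t ↦ Finset.univ.inf' hne fun q ↦ D q t,
    Finset.sum_nonneg fun q _ ↦ hCw q, Finset.sum_nonneg fun q _ ↦ hC' q, ?_, ?_, ?_, ?_,
    fun t ↦ ∑ q, ηa q t, ?_, fun t ↦ Finset.sum_nonneg fun q _ ↦ hηa0 q t, ?_⟩
  · exact (hψst (∅, p.1)).trans_le (Finset.le_sup' ψst (Finset.mem_univ _))
  · have : Tendsto (fun t ↦ ∑ q, |ζ q t|) atTop (𝓝 (∑ q : Finset (Fin N) × Fin N, (0 : ℝ))) :=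
      tendsto_finsetSum _ fun q _ ↦ by simpa using (hζ q).abs
    simpa using this
  · exact tendsto_inf'_atTop hne fun q _ ↦ hD q
  · intro t ht
    refine ⟨Finset.sum_nonneg fun q _ ↦ abs_nonneg _, ?_⟩
    refine (Finset.le_inf'_iff hne _).mpr fun q _ ↦ (hTw q t ?_).2
    exact (Finset.le_sup' Tw (Finset.mem_univ q)).trans ht
  · have : Tendsto (fun t ↦ ∑ q, ηa q t) atTop (𝓝 (∑ q : Finset (Fin N) × Fin N, (0 : ℝ))) :=
      tendsto_finsetSum _ fun q _ ↦ hηa q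
    simpa using this
  intro U a ψ₀ hψ₀ s₁ s₂ ψ hs₁ hcs₁ h12 hlip hgeom
  have hψ₀q : ψst (U, a) ≤ ψ₀ := (Finset.le_sup' ψst (Finset.mem_univ (U, a))).trans hψ₀
  have hTwq : Tw (U, a) ≤ s₁ := (Finset.le_sup' Tw (Finset.mem_univ (U, a))).trans hs₁
  obtain ⟨hlaw, hid⟩ := hcl (U, a) ψ₀ hψ₀q s₁ s₂ ψ hTwq hcs₁ h12 hlip hgeom
  have hψ₀pos : 0 < ψ₀ := (hψst (U, a)).trans_le hψ₀q
  -- the budget integral is nonnegative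
  have hInn : 0 ≤ ∫ s in s₁..s₂, (((min (ψ s / 2) (c₂ * s)) ^ 2)⁻¹ +
      ((min (ψ s / 2) (c₂ * s)) ^ (7 / 4 : ℝ))⁻¹) := by
    apply intervalIntegral.integral_nonneg h12
    intro s hs
    have hR : 0 < min (ψ s / 2) (c₂ * s) := by
      obtain ⟨hψ0, -, -⟩ := hgeom s hs
      refine lt_min (by linarith) ?_
      have : s₁ ≤ s := hs.1
      nlinarith
    positivity
  have hCwle : Cw (U, a) ≤ ∑ q, Cw q :=
    Finset.single_le_sum (fun q _ ↦ hCw q) (Finset.mem_univ (U, a))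
  have hC'le : C' (U, a) ≤ ∑ q, C' q :=
    Finset.single_le_sum (fun q _ ↦ hC' q) (Finset.mem_univ (U, a))
  have hηle : ηa (U, a) s₁ ≤ ∑ q, ηa q s₁ :=
    Finset.single_le_sum (fun q _ ↦ hηa0 q s₁) (Finset.mem_univ (U, a))
  refine ⟨fun μ ↦ (hlaw μ).trans ?_, fun s hs ↦ ?_⟩
  · have := mul_le_mul_of_nonneg_right hCwle hInn
    linarith
  · obtain ⟨h0, hk'⟩ := hid s hs
    have hsT : Tw (U, a) ≤ s := hTwq.trans hs.1
    obtain ⟨hζ0, hD1⟩ := hTw (U, a) s hsT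
    have hζle : ζ (U, a) s ≤ ∑ q, |ζ q s| :=
      (le_abs_self _).trans (Finset.single_le_sum (fun q _ ↦ abs_nonneg (ζ q s)) (Finset.mem_univ (U, a)))
    have hDle : (Finset.univ.inf' hne fun q ↦ D q s) ≤ D (U, a) s :=
      Finset.inf'_le (fun q ↦ D q s) (Finset.mem_univ (U, a))
    have hDpos : 0 < Finset.univ.inf' hne fun q ↦ D q s := by
      refine (Finset.lt_inf'_iff hne).mpr fun q _ ↦ ?_
      have hsq : Tw q ≤ s := (Finset.le_sup' Tw (Finset.mem_univ q)).trans (hs₁.trans hs.1)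
      exact one_pos.trans_le (hTw q s hsq).2
    have hU : (0 : ℝ) ≤ U.card := Nat.cast_nonneg _
    -- monotonicity of the error in the constants
    have herr : (1 + U.card) * ζ (U, a) s + C' (U, a) * (2 * (1 + 8 * U.card) / ψ₀ + 6 * U.card / D (U, a) s) ≤
        (1 + U.card) * (∑ q, |ζ q s|) +
          (∑ q, C' q) * (2 * (1 + 8 * U.card) / ψ₀ + 6 * U.card / Finset.univ.inf' hne fun q ↦ D q s) := by
      have h1 : (1 + U.card) * ζ (U, a) s ≤ (1 + U.card) * ∑ q, |ζ q s| :=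
        mul_le_mul_of_nonneg_left hζle (by positivity)
      have hinvD : 6 * U.card / D (U, a) s ≤ 6 * U.card / Finset.univ.inf' hne fun q ↦ D q s :=
        div_le_div_of_nonneg_left (by positivity) hDpos hDle
      have hbr : 0 ≤ 2 * (1 + 8 * U.card) / ψ₀ + 6 * U.card / D (U, a) s := by
        have : 0 < D (U, a) s := one_pos.trans_le hD1
        positivity
      have h2 : C' (U, a) * (2 * (1 + 8 * U.card) / ψ₀ + 6 * U.card / D (U, a) s) ≤
          (∑ q, C' q) * (2 * (1 + 8 * U.card) / ψ₀ + 6 * U.card / D (U, a) s) :=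
        mul_le_mul_of_nonneg_right hC'le hbr
      have h3 : (∑ q, C' q) * (2 * (1 + 8 * U.card) / ψ₀ + 6 * U.card / D (U, a) s) ≤
          (∑ q, C' q) * (2 * (1 + 8 * U.card) / ψ₀ + 6 * U.card / Finset.univ.inf' hne fun q ↦ D q s) :=
        mul_le_mul_of_nonneg_left (by linarith) (Finset.sum_nonneg fun q _ ↦ hC' q)
      linarith
    exact ⟨h0.trans herr, fun k' ↦ (hk' k').trans herr⟩

/-- A finite infimum of `L`-Lipschitz functions (in the two-point form) is `L`-Lipschitz. [folklore] -/
theorem inf'_lipschitz_of_forall {ι : Type*} {S : Finset ι} (hS : S.Nonempty) {f : ι → ℝ → ℝ} {L : ℝ}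
    {I : Set ℝ} (h : ∀ y ∈ S, ∀ s ∈ I, ∀ s' ∈ I, |f y s - f y s'| ≤ L * |s - s'|) :
    ∀ s ∈ I, ∀ s' ∈ I, |S.inf' hS (fun y ↦ f y s) - S.inf' hS (fun y ↦ f y s')| ≤ L * |s - s'| :=
  fun s hs s' hs' ↦ abs_inf'_sub_inf'_le hS fun y hy ↦ h y hy s hs s' hs'

/-- Derivative, continuity and `4`-Lipschitz facts of the certified coordinates
`φ(inl y) = ⟨u_y, ξ_y − ξ_a⟩` (`y` active), `φ(inl y) = μs` (`y` external), `φ(inr ⋆) = c₂s` (virtual).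
[folklore] -/
theorem coordinate_facts (hd : ∀ i, Differentiable ℝ (ξ i)) (hdc : ∀ i, Continuous (deriv (ξ i)))
    {A : Finset (Fin N)} (a : Fin N) (u : Fin N → E3) {μ c₂ t₀ : ℝ} (hμ : 0 < μ) (hμ1 : μ ≤ 1)
    (hc₂ : 0 < c₂) (hc₂1 : c₂ ≤ 1)
    (hlip : ∀ i s s', t₀ ≤ s → t₀ ≤ s' → ‖ξ i s - ξ i s'‖ ≤ 2 * |s - s'|)
    {φ φ' : Fin N ⊕ Unit → ℝ → ℝ}
    (hφA : ∀ y ∈ A, ∀ s, φ (Sum.inl y) s = @inner ℝ E3 _ (u y) (ξ y s - ξ a s))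
    (hφX : ∀ y ∉ A, ∀ s, φ (Sum.inl y) s = μ * s) (hφV : ∀ z : Unit, ∀ s, φ (Sum.inr z) s = c₂ * s)
    (hφ'A : ∀ y ∈ A, ∀ s, φ' (Sum.inl y) s = @inner ℝ E3 _ (u y) (deriv (ξ y) s - deriv (ξ a) s))
    (hφ'X : ∀ y ∉ A, ∀ s, φ' (Sum.inl y) s = μ) (hφ'V : ∀ z : Unit, ∀ s, φ' (Sum.inr z) s = c₂)
    (Y : Finset (Fin N ⊕ Unit)) (Yr : Finset (Fin N))
    (hYmem : ∀ z ∈ Y, z = Sum.inr () ∨ ∃ y ∈ Yr, z = Sum.inl y)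
    (hYru : ∀ y ∈ Yr, y ∈ A → ‖u y‖ = 1) :
    (∀ z ∈ Y, ∀ s, HasDerivAt (φ z) (φ' z s) s) ∧ (∀ z ∈ Y, Continuous (φ' z)) ∧
    (∀ z ∈ Y, ∀ s, t₀ ≤ s → ∀ s', t₀ ≤ s' → |φ z s - φ z s'| ≤ 4 * |s - s'|) := by
  refine ⟨?_, ?_, ?_⟩
  · intro z hz s
    rcases hYmem z hz with rfl | ⟨y, hy, rfl⟩
    · have : φ (Sum.inr ()) = fun s ↦ c₂ * s := funext (hφV ())
      rw [this, hφ'V]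
      simpa using (hasDerivAt_id s).const_mul c₂
    · by_cases hyA : y ∈ A
      · have : φ (Sum.inl y) = fun s ↦ @inner ℝ E3 _ (u y) (ξ y s - ξ a s) := funext (hφA y hyA)
        rw [this, hφ'A y hyA]
        exact hasDerivAt_inner_sub (hd y) (hd a) (u y) s
      · have : φ (Sum.inl y) = fun s ↦ μ * s := funext (hφX y hyA)
        rw [this, hφ'X y hyA]
        simpa using (hasDerivAt_id s).const_mul μ
  · intro z hz
    rcases hYmem z hz with rfl | ⟨y, hy, rfl⟩
    · have : φ' (Sum.inr ()) = fun _ ↦ c₂ := funext (hφ'V ())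
      rw [this]; exact continuous_const
    · by_cases hyA : y ∈ A
      · have : φ' (Sum.inl y) = fun s ↦ @inner ℝ E3 _ (u y) (deriv (ξ y) s - deriv (ξ a) s) :=
          funext (hφ'A y hyA)
        rw [this]
        exact continuous_const.inner ((hdc y).sub (hdc a))
      · have : φ' (Sum.inl y) = fun _ ↦ μ := funext (hφ'X y hyA)
        rw [this]; exact continuous_const
  · intro z hz s hs s' hs'
    rcases hYmem z hz with rfl | ⟨y, hy, rfl⟩
    · rw [hφV, hφV, ← mul_sub, abs_mul, abs_of_pos hc₂]
      exact mul_le_mul_of_nonneg_right (by linarith) (abs_nonneg _)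
    · by_cases hyA : y ∈ A
      · rw [hφA y hyA, hφA y hyA, ← inner_sub_right]
        refine (abs_inner_le_norm_of_unit (hYru y hy hyA)).trans ?_
        have h1 := hlip y s s' hs hs'
        have h2 := hlip a s s' hs hs'
        calc ‖ξ y s - ξ a s - (ξ y s' - ξ a s')‖ = ‖(ξ y s - ξ y s') - (ξ a s - ξ a s')‖ := by
              congr 1; abel
          _ ≤ ‖ξ y s - ξ y s'‖ + ‖ξ a s - ξ a s'‖ := norm_sub_le _ _
          _ ≤ 4 * |s - s'| := by linarith
      · rw [hφX y hyA, hφX y hyA, ← mul_sub, abs_mul, abs_of_pos hμ]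
        exact mul_le_mul_of_nonneg_right (by linarith) (abs_nonneg _)

end RunPrep

end Summit.FinalStateConjecture.FinalStateConjecture.Theorems.ChargeKinematics

namespace Summit.FinalStateConjecture.FinalStateConjecture.Theorems

/-- REGISTERED STUB `rule_packages` of the crux item stmt-FinalStateConjecture-10166 (second line lead, line
`old-light-leaves-the-cone`, S4): the registered signature verbatim, by `ChargeKinematics.rule_packages`. [folklore] -/
theorem rule_packages : open Literature.Geometry.Lorentzian Filter Topology MeasureTheory intervalIntegral in ∀ {N : ℕ} {M : Fin N → ℝ} {ξ v : Fin N → ℝ → E3} {κ : ℝ} {P : ℝ → E3 → ℝ → Fin 4 → ℝ} (hκ0 : 0 < κ) (hκ1 : κ < 1) (hξ : ∀ i, ContDiff ℝ ((⊤ : ℕ∞) : WithTop ℕ∞) (ξ i)) (hcone : ∀ i, ∀ᶠ t in atTop, ‖ξ i t‖ ≤ κ ^ 2 * t) (hsep : ∀ i j, i ≠ j → Tendsto (fun t ↦ ‖ξ i t - ξ j t‖) atTop atTop) (hk : ∃ k : ℝ, 0 ≤ k ∧ k < 1 ∧ ∀ i, ∀ᶠ t in atTop, ‖v i t‖ ≤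 k) (hslave : ∀ i, Tendsto (fun t ↦ deriv (ξ i) t - v i t) atTop (𝓝 0)) (hW : ∀ δ : ℝ, 0 < δ → δ < 1 → ∃ (C R₀ T : ℝ) (η : ℝ → ℝ), Tendsto η atTop (𝓝 0) ∧ ∀ (t₁ t₂ : ℝ) (c : ℝ → E3) (R : ℝ → ℝ), T ≤ t₁ → t₁ ≤ t₂ → (∀ s ∈ Set.Icc t₁ t₂, ∀ s' ∈ Set.Icc t₁ t₂, ‖c s - c s'‖ ≤ 2 * |s - s'| ∧ |R s - R s'| ≤ 2 * |s - s'|) → (∀ s ∈ Set.Icc t₁ t₂, (R₀ ≤ R s ∧ ‖c s‖ + R s ≤ (κ + κ ^ 2) / 2 * s ∧ ∀ j, ‖ξ j s - c s‖ ≤ (1 - δ) * R s ∨ (1 + δ) * R s ≤ ‖ξ j s - c s‖)) → ∀ μ : Fin 4, |P t₂ (c t₂) (R t₂) μ - P t₁ (c t₁) (R t₁) μ| ≤ C * (∫ s in t₁..t₂, ((R s) ^ 2)⁻¹ + ((R s) ^ (7 / 4 : ℝ))⁻¹) + η t₁) (hI : ∃ (C R₀ T : ℝ) (ζ : ℝ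 → ℝ), Tendsto ζ atTop (𝓝 0) ∧ (∀ (t : ℝ) (i : Fin N) (R : ℝ), T ≤ t → R₀ ≤ R → ‖ξ i t‖ + R ≤ (κ + κ ^ 2) / 2 * t → (∀ j, j ≠ i → 3 * R ≤ ‖ξ i t - ξ j t‖) → |P t (ξ i t) R 0 - M i * (√(1 - ‖v i t‖ ^ 2))⁻¹| ≤ ζ t + C / R ∧ ∀ k : Fin 3, |P t (ξ i t) R k.succ - M i * (√(1 - ‖v i t‖ ^ 2))⁻¹ * v i t k| ≤ ζ t + C / R) ∧ (∀ (t : ℝ) (c : E3) (R : ℝ) (A : Finset (Fin N)) (ρ : Fin N → ℝ), T ≤ t → R₀ ≤ R → ‖c‖ + R ≤ (κ + κ ^ 2) / 2 * t → (∀ j ∈ A, ‖ξ j t - c‖ ≤ R / 2) → (∀ j ∉ A, 2 * R ≤ ‖ξ j t - c‖) → (∀ j ∈ A, R₀ ≤ ρ j ∧ ρ j ≤ R / 4 ∧ ∀ j', j' ≠ j → 3 * ρ j ≤ ‖ξ j t - ξ j' t‖) → ∀ μ : Fin 4, |P t c R μ - ∑ j ∈ A, P t (ξ j t) (ρ j)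 μ| ≤ C * (R⁻¹ + ∑ j ∈ A, (ρ j)⁻¹) + ζ t)) (hpair : ∃ p : Fin N × Fin N, p.1 ≠ p.2) {c₂ : ℝ} (hc₂ : 0 < c₂) (hc₂κ : c₂ ≤ (κ - κ ^ 2) / 2) (hc₂1 : c₂ ≤ 1), ∃ (Cw C' ψst Tw : ℝ) (ζ D : ℝ → ℝ), 0 ≤ Cw ∧ 0 ≤ C' ∧ 0 < ψst ∧ Tendsto ζ atTop (𝓝 0) ∧ Tendsto D atTop atTop ∧ (∀ t, Tw ≤ t → 0 ≤ ζ t ∧ 1 ≤ D t) ∧ ∃ ηa : ℝ → ℝ, Tendsto ηa atTop (𝓝 0) ∧ (∀ t, 0 ≤ ηa t) ∧ ∀ (U : Finset (Fin N)) (a : Fin N), ∀ (ψ₀ : ℝ), ψst ≤ ψ₀ → ∀ (s₁ s₂ : ℝ) (ψ : ℝ → ℝ), Tw ≤ s₁ → ψ₀ ≤ c₂ * s₁ → s₁ ≤ s₂ → (∀ s ∈ Set.Icc s₁ s₂, ∀ s' ∈ Set.Icc s₁ s₂, |ψ s - ψ s'| ≤ 4 * |s - s'|) → (∀ s ∈ Set.Icc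 s₁ s₂, ψ₀ ≤ ψ s ∧ (∀ j ∈ U, 4 * ‖ξ a s - ξ j s‖ ≤ ψ s ∧ 2 * ‖ξ a s - ξ j s‖ ≤ c₂ * s) ∧ ∀ l ∉ U, ψ s ≤ ‖ξ l s - ξ a s‖) → (∀ μ : Fin 4, |P s₂ (ξ a s₂) (min (ψ s₂ / 2) (c₂ * s₂)) μ - P s₁ (ξ a s₁) (min (ψ s₁ / 2) (c₂ * s₁)) μ| ≤ Cw * (∫ s in s₁..s₂, ((min (ψ s / 2) (c₂ * s)) ^ 2)⁻¹ + ((min (ψ s / 2) (c₂ * s)) ^ (7 / 4 : ℝ))⁻¹) + ηa s₁) ∧ (∀ s ∈ Set.Icc s₁ s₂, |P s (ξ a s) (min (ψ s / 2) (c₂ * s)) 0 - ∑ j ∈ U, M j * (√(1 - ‖v j s‖ ^ 2))⁻¹| ≤ (1 + U.card) * ζ s + C' * (2 * (1 + 8 * U.card) / ψ₀ + 6 * U.card / D s) ∧ ∀ k' : Fin 3, |P s (ξ a s) (min (ψ s / 2) (c₂ * s)) k'.succ - ∑ j ∈ U, M j * (√(1 - ‖v j s‖ ^ 2))⁻¹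 * v j s k'| ≤ (1 + U.card) * ζ s + C' * (2 * (1 + 8 * U.card) / ψ₀ + 6 * U.card / D s)) :=
  @ChargeKinematics.rule_packages

end Summit.FinalStateConjecture.FinalStateConjecture.Theorems

end
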